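import Literature.Topology.FourManifolds.MorseOrderedSublevelConnected
import HarnessLib

/-!
# A regular level of a Morse function is connected when the critical points below it have
# coindex `≥ 2` and there is at most one minimum

Topic `Literature/Topology/FourManifolds`; step G (part e) / step H of a Morse-theoretic
construction of Gay–Kirby's trisection for the fact seat
`provefact-Literature.Topology.FourManifolds.exists_isBalancedGKTrisection` (Gay–Kirby 2016,
Thm. 4 via §4, Lemma 14: the level `Y = ∂X₁ = #ᵏ S¹ × S²` between the `1`- and the
`2`-handles, and the level between the `2`- and `3`-handles, are connected).  Everything in
this file is **proved**; no definitions.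

For a Morse function `f` on a closed manifold `M` of dimension `k + 1 ≥ 2` with at most one
critical point of index `0`, the sublevel set `Mᵃ = {f ≤ a}` (`a` regular) is connected
(`RegularSublevel.connectedSpace`, Reeb's argument); it is a compact manifold with boundary
`f⁻¹(a)` carrying the adapted Morse function `f + (1 - a)` with the critical points and
indices of `f` below `a` (`RegularSublevel.morseData`).  If these have coindex `≥ 2`, the tree's
"boundary of a handlebody is connected" (`IsMorseAdapted.isPreconnected_boundary_and_nonempty`,
`LickorishWallaceProofs.lean`) makes the boundary, i.e. the level `f⁻¹(a)`, preconnected and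
nonempty (`isPreconnected_level_and_nonempty`); as a space, the regular level
`Literature.RegularLevel` is connected (`connectedSpace_regularLevel`).

## References

* J. Milnor, *Morse theory* (1963), Thm. 3.1, 3.2 and Remark 3.3. [Milnor1963]
* D. Gay, R. Kirby, *Trisecting 4-manifolds*, Geom. Topol. 20 (2016), §4, Lemma 14. [GayKirby2016]
-/

open scoped Manifold ContDiff Topology
open Set Function Filter

noncomputable section

universe u

namespace Literature.Topology.FourManifolds

/-- Local notation: `𝔼 n` is the model Euclidean space `EuclideanSpace ℝ (Fin n)`. -/
local notation "𝔼 " n:arg => EuclideanSpace ℝ (Fin n)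

variable {k : ℕ} [NeZero k] {M : Type u} [TopologicalSpace M] [T2Space M] [CompactSpace M]
  [ChartedSpace (𝔼 (k + 1)) M] [IsManifold (𝓡 (k + 1)) ∞ M] {f : M → ℝ} {a : ℝ}

/-- **The level of a Morse function below which all critical points have coindex `≥ 2`, with
at most one minimum, is preconnected and nonempty.** [cite: Milnor1963, Thms. 3.1–3.2, Rem. 3.3] -/
theorem isPreconnected_level_and_nonempty (hf : IsMorse (𝓡 (k + 1)) f) (h : IsRegularLevel (𝓡 (k + 1)) f a)
    (h0 : (criticalSetOfIndex (𝓡 (k + 1)) f 0).Subsingleton)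
    (hidx : ∀ z, IsMCriticalPt (𝓡 (k + 1)) f z → f z ≤ a → morseIndex (𝓡 (k + 1)) f z + 2 ≤ k + 1)
    (hne : ∃ x, f x ≤ a) :
    IsPreconnected (f ⁻¹' {a}) ∧ (f ⁻¹' {a}).Nonempty := by
  set W : Type u := RegularSublevel h with hW
  haveI : ConnectedSpace W := RegularSublevel.connectedSpace h h0 hne
  haveI : LocallyPathConnectedSpace W := ChartedSpace.locallyPathConnectedSpace (EuclideanHalfSpace (k + 1)) W
  obtain ⟨hψ, hcrit, hind⟩ := RegularSublevel.morseData hf h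
  set ι : W → M := RegularSublevel.incl h with hι
  have hidxψ : ∀ x : W, (𝓡∂ (k + 1)).IsInteriorPoint x →
      IsMCriticalPt (𝓡∂ (k + 1)) (fun x : W => f (ι x) + (1 - a)) x →
      morseIndex (𝓡∂ (k + 1)) (fun x : W => f (ι x) + (1 - a)) x + 2 ≤ k + 1 := by
    intro x _ hx
    have hx' : IsMCriticalPt (𝓡 (k + 1)) f (ι x) := (hcrit x).1 hx
    rw [hind x hx']
    exact hidx (ι x) hx' (RegularSublevel.apply_incl_le h x)
  obtain ⟨hpre, hbne⟩ := hψ.isPreconnected_boundary_and_nonempty hidxψ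
  -- transport along `ι`: the boundary maps onto the level
  have himage : ι '' ((𝓡∂ (k + 1)).boundary W) = f ⁻¹' {a} := by
    ext y
    constructor
    · rintro ⟨x, hx, rfl⟩
      exact (RegularSublevel.mem_boundary_iff h x).1 hx
    · intro hy
      have hy' : f y = a := hy
      refine ⟨RegularSublevel.mk h y hy'.le, (RegularSublevel.mem_boundary_iff h _).2 hy', rfl⟩
  rw [← himage]
  exact ⟨hpre.image ι (RegularSublevel.continuous_incl h).continuousOn, hbne.image ι⟩

/-- **The regular level is a connected space** under the same hypotheses. [cite: Milnor1963, Thms. 3.1–3.2, Rem. 3.3] -/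
theorem connectedSpace_regularLevel (hf : IsMorse (𝓡 (k + 1)) f) (h : IsRegularLevel (𝓡 (k + 1)) f a)
    (h0 : (criticalSetOfIndex (𝓡 (k + 1)) f 0).Subsingleton)
    (hidx : ∀ z, IsMCriticalPt (𝓡 (k + 1)) f z → f z ≤ a → morseIndex (𝓡 (k + 1)) f z + 2 ≤ k + 1)
    (hne : ∃ x, f x ≤ a) : ConnectedSpace (RegularLevel h) := by
  obtain ⟨hpre, hne'⟩ := isPreconnected_level_and_nonempty hf h h0 hidx hne
  have hconn : IsConnected (f ⁻¹' {a}) := ⟨hne', hpre⟩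
  exact isConnected_iff_connectedSpace.1 hconn

end Literature.Topology.FourManifolds

end
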